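/-
Copyright (c) 2026 the pub-hodgecm-mathlib formalisation cell (harness21).  Prover seat hodgecm-mathlib-K2Liu-p05 (g5), Track B «K2-LIT»,
#184♮ = hLiu418 = `stmt-HodgeConjecture-24832`; #42S payer road, organ S1 (local Siegel–Weil spanning), ROAD W file F6a
(LEAD F0P6-plan (g14) RULING «M-158b» (1), BATCH #3; census K2Liu-p05 (g5) 12:24Z on `K2/STATUS.md`; organ lead's DESIGN-W3-v2 §0 (a), ref1 (A-W2) §0 (a)).
-/
import Summits.HodgeConjecture.HodgeConjecture.Theorems.K2LiuLocalSWBigCellWords              -- ★ F4a part 1: `moverChange`, the Weyl word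
import Literature.NumberTheory.GelbartRogawski1991.LocalSplittingCMBlockRestriction         -- ★ the local see-saw `restrictBlk (s^𝔻_{T₁⊕T₂}) = s^𝔻_{T₁}`
import Literature.NumberTheory.GelbartRogawski1991.LocalDoubledWeylElementCayleyMover       -- ★ `exists_mover_conj_iotaD_weylDelta`
import HarnessLib

/-!
# Crux `HLiu418`, #42S organ S1, ROAD W, file F6a: THE MIDDLE-CELL VALUE FUNCTIONAL OF THE LOCAL SIEGEL–WEIL SECTION ON PURE TENSORS
# `F_{Φ₁ ⊠ Φ₂}(w₁) = c · (∫ Γ₁Φ₁) · (Γ₂Φ₂)(0)`, `c ≠ 0` — «`ev₀ ∘ ω(m₀) ∘ ω(s w₁) = c · (Haar on the flipped block ⊗ δ₀ on the fixed block)`»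

Cell `hodgecm-mathlib`, crux item hLiu418 = `stmt-HodgeConjecture-24832`; squad K2 ∕ K2Liu; LEAD F0P6-plan (g14), organ lead K2Liu-p06 (g4);
prover K2Liu-p05 (g5).  THEOREMS ONLY (no `def`, no instance, no notation, no named-fact hypothesis, no `sorry`); lane
`--supports stmt-HodgeConjecture-24832 --as helper`.

WHY.  ROAD W's witness step (W3a) («`u = F_{Φ⁺} − λ F_{Φ⁻}` vanishes on the MIDDLE cell `P_Δ w₁ P_Δ`», census
`K2/K2Liu-p06/g4/CENSUS-S1-LocalSWSpanning.K2Liu-p06-g4.md`, DESIGN-W3-v2 §0 (a), RULINGS «M-158a» ADDENDUM (M1), «M-158b» (1)) needs the value of the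
local Siegel–Weil section ★ `swSectionLoc v s m₀ Φ h = (ω(m₀ · s h) Φ)(0)` (D-A v1) at the middle Weyl element `w₁` (the one flipping ONE block of
`V = V₁ ⊥ V₂`), i.e. the functional `ℓ₁ = ev₀ ∘ ω(m₀) ∘ ω(s w₁)`, known to be `c₁ · (Haar on the flipped block ⊗ δ₀ on the fixed block)`.  NO new
symplectic algebra is needed: for the block datum `T = T₁ ⊕ᶠ T₂` the middle Weyl element IS **`w₁ := blkLoc (w_Δ^{T₁})`**, the big Weyl element
of the doubled FIRST block under the doubled block embedding ★ `DoubledBlock.blkLoc : U(T₁^𝔻)(F_v) →* U((T₁ ⊕ᶠ T₂)^𝔻)(F_v)` (★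
`LocalDoubledBlockEmbedding`; adapted matrix `[[1 − E, E], [E, 1 − E]]`, `E` the projector on `V₁`), and the tree's LOCAL SEE-SAW for Kudla's CM splitting
★ `LocalSplittingCMBlockRestriction.restrictBlk_localSplittingDatumCM` (`restrictBlk (s^𝔻_{T₁ ⊕ᶠ T₂}) = s^𝔻_{T₁}`, `T₁` diagonal, `0 < n₁`, every
finite place) with ★ `toRep_blkLoc_boxSB` gives `ω(s_T w₁)(Φ₁ ⊠ Φ₂) = ω(s_{T₁} w_Δ) Φ₁ ⊠ Φ₂`; the Weyl word of the first block is ★ F4a part 1 §3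
(`exists_localOmega_weylDelta_apply_eq_smul`), the outer `m₀` is traded for Kudla's `j̃(p₁, p₂)` (★ `boxLoc`, `toRep_boxLoc_boxSB`) by ★ F4a part 1
`exists_ne_zero_swSectionLoc_moverChange`, and the Fourier operator at `0` is the total integral.

SETTING: `L` CM, `v` a finite place of `L⁺`, Haar `μ`; the BLOCK DATUM `T = UnitaryGroup.finSum n₁ n₂ T₁ T₂` with `T₁ = diagonal t₁` (`0 < n₁`),
`T₂` real symmetric non-degenerate; `D := localSplittingDatumCM L v μ (n₁ + n₂) … rfl χ hχ` Kudla's CM splitting of `U((T₁ ⊕ᶠ T₂)^𝔻)(L⁺_v)` on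
`𝒮(L⁺_v^{(n₁+n₂)+(n₁+n₂)})`; an OUTER implementer `m₀ ∈ S̃p_ψ` over ANY mover of `ℓ_Δ` onto `ℓ_Y` (`hm₀`; the `m₀` of record qualifies); block
implementers `p₁ ∈ S̃p_ψ(𝕎^𝔻_{T₁})`, `p₂ ∈ S̃p_ψ(𝕎^𝔻_{T₂})` over movers (`hp₁`, `hp₂`), `p₁` Cayley-type (`hW₁ : π(p₁) ι(w_Δ^{T₁}) π(p₁)⁻¹ = J_𝕋⁻¹ m(B₁)`,
★ `exists_mover_conj_iotaD_weylDelta`), `Γ_j := op(p_j)`.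

* §1 `glue`∕`boxSB` at the origin; `j̃(p₁, p₂)` is a mover-implementer (`map_deltaLagrangian_proj_boxLoc`, ★ `map_boxPair_deltaLagrangian`).
* §2 **`toRep_localSplitting_blkLoc_weylDelta_boxSB`** — THE SEE-SAW AT THE MIDDLE WEYL ELEMENT: `ω(s_T (blkLoc w_Δ))(Φ₁ ⊠ Φ₂) = ω_{T₁}(w_Δ)Φ₁ ⊠ Φ₂`.
* §3 **`exists_ne_zero_swSectionLoc_boxSB_blkLoc_weylDelta`** — THE HEAD: `∃ c ≠ 0, ∀ Φ₁ Φ₂,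
  swSectionLoc v s_T m₀ (Φ₁ ⊠ Φ₂) (blkLoc w_Δ^{T₁}) = c · (∫ x, (Γ₁ Φ₁) x ∂μ^{⊗(n₁+n₁)}) · (Γ₂ Φ₂)(0)`.
* §4 **`exists_ne_zero_swSectionLoc_blkLoc_weylDelta_eq_mul_of_boxSB`** — on ALL of `𝒮`: `∃ c ≠ 0, ∀ Ψ, F_Ψ(w₁) = c · Λ Ψ` for ANY linear `Λ` with
  `Λ(Φ₁ ⊠ Φ₂) = (∫ Γ₁Φ₁) · (Γ₂Φ₂)(0)` (pure tensors span, ★ `linearMap_ext_boxSB`) — the consumer plugs in its explicit `c₁ · (Haar ⊗ δ₀)`.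
NOT HERE (F6c): the compositions with `n(t)`, `m(a)` (middle-cell values
`F_Φ(w₁ n(t) m(a))`, DESIGN-W3-v2 §0 (a)), ref1's (A-W2) R2 `middleCell_…_Ad_dUnit`, and the frame transport to the tensor datum of record.
References: [Kudla1984] §1 (see-saw pairs); [Kudla1994] §2–§3, Thm. 3.1; [MoeglinVignerasWaldspurger1987] Chap. 2 II.1 Rem. (6), II.6; [Rangarao1993] §3.1 (3.9),
Lemma 3.2 p. 351; [Weil1964] n° 13 p. 160; [KudlaRallis1994] §1; [HarrisKudlaSweet1996] §1 (1.11).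
HONEST LABEL.  Count-neutral helper: `HC_CM` is proved only modulo the 7 printed citations (2 remaining named inputs: hLiu418 = `stmt-HodgeConjecture-24832`,
h413 = `stmt-HodgeConjecture-24833`) until rung 0 closes.
-/

set_option autoImplicit false
set_option linter.dupNamespace false -- the mandated namespace repeats `HodgeConjecture.HodgeConjecture`

noncomputable section

open scoped Matrix
open NumberField IsDedekindDomain MeasureTheory MeasureTheory.Measure Matrix
open Literature.RepresentationTheory.HeisenbergGroup Literature.RepresentationTheory.HeisenbergGroup.SymplecticMatrix
open Literature.NumberTheory.Automorphic Literature.NumberTheory.Automorphic.UnitaryGroup Literature.NumberTheory.Weil1964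
open Literature.NumberTheory.GaloisRepresentations Literature.NumberTheory.GaloisRepresentations.IsNonarchimedeanLocalField
open Literature.RepresentationTheory.HarrisKudlaSweet1996
open Literature.NumberTheory.GelbartRogawski1991.UnitaryDualPair
open Literature.NumberTheory.GelbartRogawski1991.UnitaryDualPair.LocalSplitting
open Literature.NumberTheory.GelbartRogawski1991.UnitaryDualPair.LocalSplitting.DoubledBlock
open Summit.HodgeConjecture.HodgeConjecture.Cruxes.HLiu418.K2LiuLocalSWSectionDefs
open Summit.HodgeConjecture.HodgeConjecture.Cruxes.HLiu418.K2LiuLocalSWBigCellWords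

namespace Summit.HodgeConjecture.HodgeConjecture.Cruxes.HLiu418.K2LiuLocalSWMiddleCellFunctional

variable (L : Type) [Field L] [NumberField L] [IsCMField L] (v : HeightOneSpectrum (𝓞 (maximalRealSubfield L)))
  [MeasurableSpace (v.adicCompletion (maximalRealSubfield L))] [BorelSpace (v.adicCompletion (maximalRealSubfield L))]
  (μ : Measure (v.adicCompletion (maximalRealSubfield L))) [μ.IsAddHaarMeasure]
  (n₁ n₂ : ℕ) {T₁ : Matrix (Fin n₁) (Fin n₁) (maximalRealSubfield L)} {T₂ : Matrix (Fin n₂) (Fin n₂) (maximalRealSubfield L)}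
  (hT₁ : T₁.IsSymm) (hT₂ : T₂.IsSymm) (hT₁d : IsUnit T₁.det) (hT₂d : IsUnit T₂.det)

/-! ## §1 Bookkeeping: pure tensors at the origin; `j̃(p₁, p₂)` is a mover-implementer -/

omit [IsCMField L] [MeasurableSpace (v.adicCompletion (maximalRealSubfield L))] [BorelSpace (v.adicCompletion (maximalRealSubfield L))] in
/-- `(Φ₁ ⊠ Φ₂)(0) = Φ₁(0) · Φ₂(0)`. [cite: WeilBNT1967, Chap. VII §2, Prop. 2] -/
theorem boxSB_apply_zero (Φ₁ : SchwartzBruhat (Fin (n₁ + n₁) → v.adicCompletion (maximalRealSubfield L)))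
    (Φ₂ : SchwartzBruhat (Fin (n₂ + n₂) → v.adicCompletion (maximalRealSubfield L))) :
    ((boxSB (v.adicCompletion (maximalRealSubfield L)) (blkIdx n₁ n₂) Φ₁ Φ₂ :
        SchwartzBruhat (Fin ((n₁ + n₂) + (n₁ + n₂)) → v.adicCompletion (maximalRealSubfield L))) :
          (Fin ((n₁ + n₂) + (n₁ + n₂)) → v.adicCompletion (maximalRealSubfield L)) → ℂ) 0 =
      ((Φ₁ : SchwartzBruhat (Fin (n₁ + n₁) → v.adicCompletion (maximalRealSubfield L))) :
          (Fin (n₁ + n₁) → v.adicCompletion (maximalRealSubfield L)) → ℂ) 0 *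
        ((Φ₂ : SchwartzBruhat (Fin (n₂ + n₂) → v.adicCompletion (maximalRealSubfield L))) :
          (Fin (n₂ + n₂) → v.adicCompletion (maximalRealSubfield L)) → ℂ) 0 := by
  simp only [coe_boxSB, resL_zero, resR_zero]

omit [IsCMField L] [MeasurableSpace (v.adicCompletion (maximalRealSubfield L))] [BorelSpace (v.adicCompletion (maximalRealSubfield L))] in
/-- **Kudla's `j̃(p₁, p₂)` is a mover-implementer**: if `π(p_j)` carries `ℓ_Δ(T_j)` onto `ℓ_Y` (`j = 1, 2`), then `π(j̃(p₁, p₂))` carries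
`ℓ_Δ(T₁ ⊕ᶠ T₂)` onto `ℓ_Y` (★ `proj_boxLoc`, ★ `map_boxPair_deltaLagrangian`). [cite: Kudla1994, §3] [cite: HarrisKudlaSweet1996, §1 (1.11)] -/
theorem map_deltaLagrangian_proj_boxLoc
    (p₁ : LocalMp (maximalRealSubfield L) (n₁ + n₁) (gramD (maximalRealSubfield L) n₁ T₁) v)
    (p₂ : LocalMp (maximalRealSubfield L) (n₂ + n₂) (gramD (maximalRealSubfield L) n₂ T₂) v)
    (hp₁ : (deltaLagrangian (maximalRealSubfield L) v n₁).map (toLin (maximalRealSubfield L) v (MpPsi.proj _ p₁)) =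
      lagrangianY (maximalRealSubfield L) (n₁ + n₁) v)
    (hp₂ : (deltaLagrangian (maximalRealSubfield L) v n₂).map (toLin (maximalRealSubfield L) v (MpPsi.proj _ p₂)) =
      lagrangianY (maximalRealSubfield L) (n₂ + n₂) v) :
    (deltaLagrangian (maximalRealSubfield L) v (n₁ + n₂)).map (toLin (maximalRealSubfield L) v
        (MpPsi.proj _ (boxLoc (maximalRealSubfield L) v n₁ n₂ (T₁ := T₁) (T₂ := T₂) (p₁, p₂)))) =
      lagrangianY (maximalRealSubfield L) ((n₁ + n₂) + (n₁ + n₂)) v := by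
  rw [proj_boxLoc]
  exact map_boxPair_deltaLagrangian (maximalRealSubfield L) v n₁ n₂ _ _ hp₁ hp₂

/-! ## §2 The see-saw at the middle Weyl element `w₁ = blkLoc (w_Δ^{T₁})` -/

variable (χ : HeckeCharacter L) (hχ : IsSplittingChar L 1 χ)

set_option maxHeartbeats 4000000 in -- the doubled CM datum's telescope (as ★ `LocalSplittingCMBlockRestriction`)
/-- **THE SEE-SAW AT THE MIDDLE WEYL ELEMENT**: for Kudla's CM splitting `s_T` of `U((T₁ ⊕ᶠ T₂)^𝔻)(L⁺_v)` (`T₁ = diagonal t₁`, `0 < n₁`) and its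
first-block twin `s_{T₁}`: `ω(s_T (blkLoc h))(Φ₁ ⊠ Φ₂) = ω_{T₁}(h) Φ₁ ⊠ Φ₂` for every `h ∈ U(T₁^𝔻)(L⁺_v)` — in particular at `h = w_Δ^{T₁}`, where
`blkLoc w_Δ^{T₁}` is a MIDDLE Weyl element of the big doubled group (★ `toRep_blkLoc_boxSB` + ★ `restrictBlk_localSplittingDatumCM`).
[cite: Kudla1984, §1] [cite: Kudla1994, §3 Thm. 3.1] [cite: MoeglinVignerasWaldspurger1987, Chap. 2 II.1 Rem. (6)] -/
theorem toRep_localSplitting_blkLoc_boxSB (hn₁ : 0 < n₁) (t₁ : Fin n₁ → maximalRealSubfield L) (hT₁t : T₁ = Matrix.diagonal t₁)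
    (h : UnitaryGroup.localPi L (IsCMField.complexConj L) (n₁ + n₁)
      ((gramD (maximalRealSubfield L) n₁ T₁).map (algebraMap (maximalRealSubfield L) L)) v)
    (Φ₁ : SchwartzBruhat (Fin (n₁ + n₁) → v.adicCompletion (maximalRealSubfield L)))
    (Φ₂ : SchwartzBruhat (Fin (n₂ + n₂) → v.adicCompletion (maximalRealSubfield L))) :
    MpPsi.toRep (localSchrodinger (maximalRealSubfield L) ((n₁ + n₂) + (n₁ + n₂))
        (gramD (maximalRealSubfield L) (n₁ + n₂) (UnitaryGroup.finSum n₁ n₂ T₁ T₂)) v)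
        ((localSplittingDatumCM L v μ (n₁ + n₂) (UnitaryGroup.isSymm_finSum hT₁ hT₂) (isUnit_det_finSum L n₁ n₂ hT₁d hT₂d) rfl χ hχ).localSplitting
          (blkLoc (maximalRealSubfield L) L (IsCMField.complexConj L) v n₁ n₂ (T₁ := T₁) (T₂ := T₂) rfl rfl h))
        (boxSB (v.adicCompletion (maximalRealSubfield L)) (blkIdx n₁ n₂) Φ₁ Φ₂) =
      boxSB (v.adicCompletion (maximalRealSubfield L)) (blkIdx n₁ n₂)
        ((localSplittingDatumCM L v μ n₁ hT₁ hT₁d rfl χ hχ).localOmega h Φ₁) Φ₂ := by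
  rw [toRep_blkLoc_boxSB (maximalRealSubfield L) L (IsCMField.complexConj L) v n₁ n₂ (T₁ := T₁) (T₂ := T₂) rfl rfl (complexConj_imagUnit L)
      (imagUnit_ne_zero L) (imagUnit_mul_self L) hT₁ hT₂ hT₂d
      (localSplittingDatumCM L v μ (n₁ + n₂) (UnitaryGroup.isSymm_finSum hT₁ hT₂) (isUnit_det_finSum L n₁ n₂ hT₁d hT₂d) rfl χ hχ).localSplitting
      (fun g => (localSplittingDatumCM L v μ (n₁ + n₂) (UnitaryGroup.isSymm_finSum hT₁ hT₂)
        (isUnit_det_finSum L n₁ n₂ hT₁d hT₂d) rfl χ hχ).proj_localSplitting g) h Φ₁ Φ₂,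
    restrictBlk_localSplittingDatumCM L v μ n₁ n₂ hT₁ hT₂ hT₁d hT₂d χ hχ hn₁ t₁ hT₁t]
  rfl

/-! ## §3 THE HEAD: the middle-cell value on pure tensors -/

include hT₁d in
set_option maxHeartbeats 4000000 in -- the doubled CM datum's telescope (as ★ `LocalSplittingCMBlockRestriction`)
/-- **THE MIDDLE-CELL VALUE OF THE LOCAL SIEGEL–WEIL SECTION ON PURE TENSORS, UP TO ONE NON-ZERO SCALAR.**  For Kudla's CM splitting `s_T` of
`U((T₁ ⊕ᶠ T₂)^𝔻)(L⁺_v)` (`T₁ = diagonal t₁`, `0 < n₁`), an OUTER implementer `m₀` over ANY mover of `ℓ_Δ` onto `ℓ_Y`, and block mover-implementers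
`(E₁, Γ₁)` Cayley-type (`E₁ ι(w_Δ^{T₁}) E₁⁻¹ = J_𝕋⁻¹ m(B₁)`, ★ `exists_mover_conj_iotaD_weylDelta`) and `(E₂, Γ₂)` (any): there is ONE `c ≠ 0` with, for all
`Φ₁`, `Φ₂`, `swSectionLoc v s_T m₀ (Φ₁ ⊠ Φ₂) (blkLoc w_Δ^{T₁}) = c · (∫ x, (Γ₁ Φ₁) x dμ^{⊗(n₁+n₁)}) · (Γ₂ Φ₂)(0)` — «`ℓ₁ = c · (Haar₁ ⊗ δ₀) ∘ (Γ₁ ⊠ Γ₂)`».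
Proof: trade `m₀` for `j̃((E₁,Γ₁), (E₂,Γ₂))` (★ `exists_ne_zero_swSectionLoc_moverChange`), see-saw (§2), the Weyl word of the first block
(★ `exists_localOmega_weylDelta_apply_eq_smul`), `ω(j̃(p₁, p₂))(X ⊠ Φ₂) = op p₁ X ⊠ op p₂ Φ₂` (★ `toRep_boxLoc_boxSB`), and the Fourier operator at `0` is the
total integral (★ `fourierOpPi_mul_leviOpPi`). [cite: Kudla1984, §1] [cite: Kudla1994, §3 Thm. 3.1] [cite: MoeglinVignerasWaldspurger1987, Chap. 2 II.1 Rem. (6), II.6]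
[cite: Rangarao1993, §3.1 (3.9), Lemma 3.2, p. 351] [cite: Weil1964, n° 13, p. 160] [cite: KudlaRallis1994, §1] -/
theorem exists_ne_zero_swSectionLoc_boxSB_blkLoc_weylDelta (hn₁ : 0 < n₁) (t₁ : Fin n₁ → maximalRealSubfield L) (hT₁t : T₁ = Matrix.diagonal t₁)
    (hTv₁ : IsUnit (localGram (maximalRealSubfield L) (n₁ + n₁) (gramD (maximalRealSubfield L) n₁ T₁) v).det)
    (m₀ : LocalMp (maximalRealSubfield L) ((n₁ + n₂) + (n₁ + n₂)) (gramD (maximalRealSubfield L) (n₁ + n₂) (UnitaryGroup.finSum n₁ n₂ T₁ T₂)) v)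
    (hm₀ : (deltaLagrangian (maximalRealSubfield L) v (n₁ + n₂)).map (toLin (maximalRealSubfield L) v (MpPsi.proj _ m₀)) =
      lagrangianY (maximalRealSubfield L) ((n₁ + n₂) + (n₁ + n₂)) v)
    (E₁ : LocalSp (maximalRealSubfield L) (n₁ + n₁) (gramD (maximalRealSubfield L) n₁ T₁) v)
    (hE₁ : (deltaLagrangian (maximalRealSubfield L) v n₁).map (toLin (maximalRealSubfield L) v E₁) = lagrangianY (maximalRealSubfield L) (n₁ + n₁) v)
    (Γ₁ : SchwartzBruhat (Fin (n₁ + n₁) → v.adicCompletion (maximalRealSubfield L)) ≃ₗ[ℂ]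
      SchwartzBruhat (Fin (n₁ + n₁) → v.adicCompletion (maximalRealSubfield L)))
    (hΓ₁ : Implements (localSchrodinger (maximalRealSubfield L) (n₁ + n₁) (gramD (maximalRealSubfield L) n₁ T₁) v) (ofSymplectic _ E₁) Γ₁)
    (B₁ : GL (Fin (n₁ + n₁)) (v.adicCompletion (maximalRealSubfield L)))
    (hW₁ : E₁ * iotaD (maximalRealSubfield L) L (IsCMField.complexConj L) (complexConj_imagUnit L) (imagUnit_ne_zero L)
        (imagUnit_mul_self L) v n₁ hT₁ rfl (weylDelta (maximalRealSubfield L) L (IsCMField.complexConj L) v n₁ (T₀ := T₁) rfl) * E₁⁻¹ =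
      (transportSp (localGram (maximalRealSubfield L) (n₁ + n₁) (gramD (maximalRealSubfield L) n₁ T₁) v) hTv₁ (SymplecticGroup.symJ _ _))⁻¹ *
        transportSp (localGram (maximalRealSubfield L) (n₁ + n₁) (gramD (maximalRealSubfield L) n₁ T₁) v) hTv₁ (levi B₁))
    {m : ℤ} (hm : (adeleAddCharAt (maximalRealSubfield L) v).HasConductorExp m)
    (E₂ : LocalSp (maximalRealSubfield L) (n₂ + n₂) (gramD (maximalRealSubfield L) n₂ T₂) v)
    (hE₂ : (deltaLagrangian (maximalRealSubfield L) v n₂).map (toLin (maximalRealSubfield L) v E₂) = lagrangianY (maximalRealSubfield L) (n₂ + n₂) v)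
    (Γ₂ : SchwartzBruhat (Fin (n₂ + n₂) → v.adicCompletion (maximalRealSubfield L)) ≃ₗ[ℂ]
      SchwartzBruhat (Fin (n₂ + n₂) → v.adicCompletion (maximalRealSubfield L)))
    (hΓ₂ : Implements (localSchrodinger (maximalRealSubfield L) (n₂ + n₂) (gramD (maximalRealSubfield L) n₂ T₂) v) (ofSymplectic _ E₂) Γ₂) :
    ∃ c : ℂ, c ≠ 0 ∧ ∀ (Φ₁ : SchwartzBruhat (Fin (n₁ + n₁) → v.adicCompletion (maximalRealSubfield L)))
      (Φ₂ : SchwartzBruhat (Fin (n₂ + n₂) → v.adicCompletion (maximalRealSubfield L))),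
      swSectionLoc L v
          (localSplittingDatumCM L v μ (n₁ + n₂) (UnitaryGroup.isSymm_finSum hT₁ hT₂) (isUnit_det_finSum L n₁ n₂ hT₁d hT₂d) rfl χ hχ).localSplitting
          m₀ (boxSB (v.adicCompletion (maximalRealSubfield L)) (blkIdx n₁ n₂) Φ₁ Φ₂)
          (blkLoc (maximalRealSubfield L) L (IsCMField.complexConj L) v n₁ n₂ (T₁ := T₁) (T₂ := T₂) rfl rfl
            (weylDelta (maximalRealSubfield L) L (IsCMField.complexConj L) v n₁ (T₀ := T₁) rfl)) =
        c * ((∫ x : Fin (n₁ + n₁) → v.adicCompletion (maximalRealSubfield L),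
              ((Γ₁ Φ₁ : SchwartzBruhat (Fin (n₁ + n₁) → v.adicCompletion (maximalRealSubfield L))) :
                (Fin (n₁ + n₁) → v.adicCompletion (maximalRealSubfield L)) → ℂ) x ∂(Measure.pi fun _ => μ)) *
            ((Γ₂ Φ₂ : SchwartzBruhat (Fin (n₂ + n₂) → v.adicCompletion (maximalRealSubfield L))) :
              (Fin (n₂ + n₂) → v.adicCompletion (maximalRealSubfield L)) → ℂ) 0) := by
  have hψ := isContinuousNontrivial_adeleAddCharAt (maximalRealSubfield L) v
  have hTv := isUnit_det_localGram_gramD (maximalRealSubfield L) v (n₁ + n₂) (isUnit_det_finSum L n₁ n₂ hT₁d hT₂d)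
  -- the block data as elements of the metaplectic groups of pairs
  obtain ⟨p₁, hp₁E, hp₁Γ⟩ : ∃ p₁ : LocalMp (maximalRealSubfield L) (n₁ + n₁) (gramD (maximalRealSubfield L) n₁ T₁) v,
      MpPsi.proj _ p₁ = E₁ ∧ MpPsi.toOp _ p₁ = Γ₁ :=
    ⟨⟨(E₁, Γ₁), (mem_MpPsi _ (E₁, Γ₁)).2 hΓ₁⟩, rfl, rfl⟩
  obtain ⟨p₂, hp₂E, hp₂Γ⟩ : ∃ p₂ : LocalMp (maximalRealSubfield L) (n₂ + n₂) (gramD (maximalRealSubfield L) n₂ T₂) v,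
      MpPsi.proj _ p₂ = E₂ ∧ MpPsi.toOp _ p₂ = Γ₂ :=
    ⟨⟨(E₂, Γ₂), (mem_MpPsi _ (E₂, Γ₂)).2 hΓ₂⟩, rfl, rfl⟩
  have hp₁ : (deltaLagrangian (maximalRealSubfield L) v n₁).map (toLin (maximalRealSubfield L) v (MpPsi.proj _ p₁)) =
      lagrangianY (maximalRealSubfield L) (n₁ + n₁) v := by rw [hp₁E]; exact hE₁
  have hp₂ : (deltaLagrangian (maximalRealSubfield L) v n₂).map (toLin (maximalRealSubfield L) v (MpPsi.proj _ p₂)) =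
      lagrangianY (maximalRealSubfield L) (n₂ + n₂) v := by rw [hp₂E]; exact hE₂
  have hp₁Γ' : ∀ X, MpPsi.toRep (localSchrodinger (maximalRealSubfield L) (n₁ + n₁) (gramD (maximalRealSubfield L) n₁ T₁) v) p₁ X = Γ₁ X :=
    fun X => by rw [← hp₁Γ]; rfl
  have hp₂Γ' : ∀ X, MpPsi.toRep (localSchrodinger (maximalRealSubfield L) (n₂ + n₂) (gramD (maximalRealSubfield L) n₂ T₂) v) p₂ X = Γ₂ X :=
    fun X => by rw [← hp₂Γ]; rfl
  -- (1) the Weyl word of the first block: `ω_{T₁}(w_Δ) Φ = γ_w • Γ₁⁻¹ (𝓕 (m(B₁) (Γ₁ Φ)))`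
  obtain ⟨γw, hγw⟩ := exists_localOmega_weylDelta_apply_eq_smul L v μ n₁ hT₁ rfl hTv₁
    (localSplittingDatumCM L v μ n₁ hT₁ hT₁d rfl χ hχ) E₁ Γ₁ hΓ₁ B₁ hW₁ hm
  -- (2) trade `m₀` for `j̃(p₁, p₂)`: `F^{m₀} = κ · F^{j̃(p₁,p₂)}`, `κ ≠ 0`
  obtain ⟨κ, hκ0, hκ⟩ := exists_ne_zero_swSectionLoc_moverChange L v (n₁ + n₂) hTv
    (localSplittingDatumCM L v μ (n₁ + n₂) (UnitaryGroup.isSymm_finSum hT₁ hT₂) (isUnit_det_finSum L n₁ n₂ hT₁d hT₂d) rfl χ hχ).localSplitting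
    (deltaLagrangian (maximalRealSubfield L) v (n₁ + n₂))
    (boxLoc (maximalRealSubfield L) v n₁ n₂ (T₁ := T₁) (T₂ := T₂) (p₁, p₂)) m₀
    (map_deltaLagrangian_proj_boxLoc L v n₁ n₂ p₁ p₂ hp₁ hp₂) hm₀
  have hm1 : ((modSqrt (dualLeviPi (glEquiv B₁)) : ℂ)) ≠ 0 := by
    rw [← coe_modSqrtUnit]
    exact (modSqrtUnit (dualLeviPi (glEquiv B₁))).ne_zero
  refine ⟨κ * ((γw : ℂ) * ((modSqrt (dualLeviPi (glEquiv B₁)) : ℂ))⁻¹),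
    mul_ne_zero hκ0 (mul_ne_zero γw.ne_zero (inv_ne_zero hm1)), fun Φ₁ Φ₂ => ?_⟩
  -- (3) the section for `j̃(p₁, p₂)`: see-saw + Weyl word + `ω(j̃(p₁,p₂))(X ⊠ Φ₂) = op p₁ X ⊠ op p₂ Φ₂`
  have hop : MpPsi.toRep (localSchrodinger (maximalRealSubfield L) ((n₁ + n₂) + (n₁ + n₂))
        (gramD (maximalRealSubfield L) (n₁ + n₂) (UnitaryGroup.finSum n₁ n₂ T₁ T₂)) v)
        (boxLoc (maximalRealSubfield L) v n₁ n₂ (T₁ := T₁) (T₂ := T₂) (p₁, p₂) *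
          (localSplittingDatumCM L v μ (n₁ + n₂) (UnitaryGroup.isSymm_finSum hT₁ hT₂) (isUnit_det_finSum L n₁ n₂ hT₁d hT₂d) rfl χ hχ).localSplitting
            (blkLoc (maximalRealSubfield L) L (IsCMField.complexConj L) v n₁ n₂ (T₁ := T₁) (T₂ := T₂) rfl rfl
              (weylDelta (maximalRealSubfield L) L (IsCMField.complexConj L) v n₁ (T₀ := T₁) rfl)))
        (boxSB (v.adicCompletion (maximalRealSubfield L)) (blkIdx n₁ n₂) Φ₁ Φ₂) =
      (γw : ℂ) • boxSB (v.adicCompletion (maximalRealSubfield L)) (blkIdx n₁ n₂)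
        (fourierOpPi μ hψ hm (leviOpPi (glEquiv B₁) (Γ₁ Φ₁))) (Γ₂ Φ₂) := by
    rw [rep_mul_apply (MpPsi.toRep (localSchrodinger (maximalRealSubfield L) ((n₁ + n₂) + (n₁ + n₂))
        (gramD (maximalRealSubfield L) (n₁ + n₂) (UnitaryGroup.finSum n₁ n₂ T₁ T₂)) v))
        (boxLoc (maximalRealSubfield L) v n₁ n₂ (T₁ := T₁) (T₂ := T₂) (p₁, p₂)) _
        (boxSB (v.adicCompletion (maximalRealSubfield L)) (blkIdx n₁ n₂) Φ₁ Φ₂),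
      toRep_localSplitting_blkLoc_boxSB L v μ n₁ n₂ hT₁ hT₂ hT₁d hT₂d χ hχ hn₁ t₁ hT₁t _ Φ₁ Φ₂, hγw Φ₁,
      boxSB_smul_left (v.adicCompletion (maximalRealSubfield L)) (blkIdx n₁ n₂) (γw : ℂ) _ Φ₂, LinearMap.map_smul,
      toRep_boxLoc_boxSB (maximalRealSubfield L) v n₁ n₂ p₁ p₂ _ Φ₂, hp₁Γ', hp₂Γ', LinearEquiv.apply_symm_apply]
  -- (4) the Fourier operator at `0` is the total integral, `m(B₁)` moves into the scalar
  have hFL := congrArg (fun T : SchwartzBruhat (Fin (n₁ + n₁) → v.adicCompletion (maximalRealSubfield L)) ≃ₗ[ℂ]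
      SchwartzBruhat (Fin (n₁ + n₁) → v.adicCompletion (maximalRealSubfield L)) => T (Γ₁ Φ₁)) (fourierOpPi_mul_leviOpPi μ hψ hm (glEquiv B₁))
  simp only [LinearEquiv.mul_apply] at hFL
  have h0 : ((fourierOpPi μ hψ hm (leviOpPi (glEquiv B₁) (Γ₁ Φ₁)) : SchwartzBruhat (Fin (n₁ + n₁) → v.adicCompletion (maximalRealSubfield L))) :
        (Fin (n₁ + n₁) → v.adicCompletion (maximalRealSubfield L)) → ℂ) 0 =
      ((modSqrt (dualLeviPi (glEquiv B₁)) : ℂ))⁻¹ * ∫ x : Fin (n₁ + n₁) → v.adicCompletion (maximalRealSubfield L),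
        ((Γ₁ Φ₁ : SchwartzBruhat (Fin (n₁ + n₁) → v.adicCompletion (maximalRealSubfield L))) :
          (Fin (n₁ + n₁) → v.adicCompletion (maximalRealSubfield L)) → ℂ) x ∂(Measure.pi fun _ => μ) := by
    rw [hFL, coe_leviOpPi_apply, LinearEquiv.map_zero, coe_fourierOpPi, piFourierSB_apply]
    congr 1
    refine integral_congr_ae (Filter.Eventually.of_forall fun x => ?_)
    simp only [dotProduct_zero, AddChar.map_zero_eq_one, Circle.coe_one, one_mul]
  rw [hκ]
  unfold swSectionLoc
  rw [hop, Submodule.coe_smul, Pi.smul_apply, smul_eq_mul, boxSB_apply_zero, h0]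
  ring

/-! ## §4 The middle-cell value functional on ALL of `𝒮(L⁺_v^{(n₁+n₂)+(n₁+n₂)})` -/

include hT₁d in
set_option maxHeartbeats 4000000 in -- the doubled CM datum's telescope (as ★ `LocalSplittingCMBlockRestriction`)
/-- **THE MIDDLE-CELL VALUE FUNCTIONAL `ℓ₁ = ev₀ ∘ ω(m₀) ∘ ω(s_T w₁)` IS `c · Λ` FOR ANY LINEAR `Λ` WITH `Λ(Φ₁ ⊠ Φ₂) = (∫ Γ₁Φ₁) · (Γ₂Φ₂)(0)`**
(`c ≠ 0`; same data as §3): pure tensors span `𝒮(L⁺_v^{(n₁+n₂)+(n₁+n₂)})` (★ `linearMap_ext_boxSB`), `Ψ ↦ F_Ψ(w₁)` is linear (★ `swSectionLoc_add`,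
★ `swSectionLoc_smul`), and §3.  So on the whole middle cell `F_Ψ(p · w₁ · p′) = e(p) · c · Λ(ω(s_T p′) Ψ)` (★ `swSectionLoc_mul_right` + the Siegel law);
the consumer supplies its own explicit `Λ` (e.g. `Ψ ↦ ∫_{x₁} ((Γ₁ ⊠ Γ₂) Ψ)(x₁ ⊔ 0) dx₁`, DESIGN-W3-v2 §0 (a) «`c₁ · (Haar ⊗ δ₀)`»).
[cite: Kudla1984, §1] [cite: Kudla1994, §3 Thm. 3.1] [cite: MoeglinVignerasWaldspurger1987, Chap. 2 II.1 Rem. (6), II.6] [cite: WeilBNT1967, Chap. VII §2, Prop. 2]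
[cite: KudlaRallis1994, §1] -/
theorem exists_ne_zero_swSectionLoc_blkLoc_weylDelta_eq_mul_of_boxSB (hn₁ : 0 < n₁) (t₁ : Fin n₁ → maximalRealSubfield L)
    (hT₁t : T₁ = Matrix.diagonal t₁)
    (hTv₁ : IsUnit (localGram (maximalRealSubfield L) (n₁ + n₁) (gramD (maximalRealSubfield L) n₁ T₁) v).det)
    (m₀ : LocalMp (maximalRealSubfield L) ((n₁ + n₂) + (n₁ + n₂)) (gramD (maximalRealSubfield L) (n₁ + n₂) (UnitaryGroup.finSum n₁ n₂ T₁ T₂)) v)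
    (hm₀ : (deltaLagrangian (maximalRealSubfield L) v (n₁ + n₂)).map (toLin (maximalRealSubfield L) v (MpPsi.proj _ m₀)) =
      lagrangianY (maximalRealSubfield L) ((n₁ + n₂) + (n₁ + n₂)) v)
    (E₁ : LocalSp (maximalRealSubfield L) (n₁ + n₁) (gramD (maximalRealSubfield L) n₁ T₁) v)
    (hE₁ : (deltaLagrangian (maximalRealSubfield L) v n₁).map (toLin (maximalRealSubfield L) v E₁) = lagrangianY (maximalRealSubfield L) (n₁ + n₁) v)
    (Γ₁ : SchwartzBruhat (Fin (n₁ + n₁) → v.adicCompletion (maximalRealSubfield L)) ≃ₗ[ℂ]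
      SchwartzBruhat (Fin (n₁ + n₁) → v.adicCompletion (maximalRealSubfield L)))
    (hΓ₁ : Implements (localSchrodinger (maximalRealSubfield L) (n₁ + n₁) (gramD (maximalRealSubfield L) n₁ T₁) v) (ofSymplectic _ E₁) Γ₁)
    (B₁ : GL (Fin (n₁ + n₁)) (v.adicCompletion (maximalRealSubfield L)))
    (hW₁ : E₁ * iotaD (maximalRealSubfield L) L (IsCMField.complexConj L) (complexConj_imagUnit L) (imagUnit_ne_zero L)
        (imagUnit_mul_self L) v n₁ hT₁ rfl (weylDelta (maximalRealSubfield L) L (IsCMField.complexConj L) v n₁ (T₀ := T₁) rfl) * E₁⁻¹ =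
      (transportSp (localGram (maximalRealSubfield L) (n₁ + n₁) (gramD (maximalRealSubfield L) n₁ T₁) v) hTv₁ (SymplecticGroup.symJ _ _))⁻¹ *
        transportSp (localGram (maximalRealSubfield L) (n₁ + n₁) (gramD (maximalRealSubfield L) n₁ T₁) v) hTv₁ (levi B₁))
    {m : ℤ} (hm : (adeleAddCharAt (maximalRealSubfield L) v).HasConductorExp m)
    (E₂ : LocalSp (maximalRealSubfield L) (n₂ + n₂) (gramD (maximalRealSubfield L) n₂ T₂) v)
    (hE₂ : (deltaLagrangian (maximalRealSubfield L) v n₂).map (toLin (maximalRealSubfield L) v E₂) = lagrangianY (maximalRealSubfield L) (n₂ + n₂) v)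
    (Γ₂ : SchwartzBruhat (Fin (n₂ + n₂) → v.adicCompletion (maximalRealSubfield L)) ≃ₗ[ℂ]
      SchwartzBruhat (Fin (n₂ + n₂) → v.adicCompletion (maximalRealSubfield L)))
    (hΓ₂ : Implements (localSchrodinger (maximalRealSubfield L) (n₂ + n₂) (gramD (maximalRealSubfield L) n₂ T₂) v) (ofSymplectic _ E₂) Γ₂)
    (Λ : SchwartzBruhat (Fin ((n₁ + n₂) + (n₁ + n₂)) → v.adicCompletion (maximalRealSubfield L)) →ₗ[ℂ] ℂ)
    (hΛ : ∀ (Φ₁ : SchwartzBruhat (Fin (n₁ + n₁) → v.adicCompletion (maximalRealSubfield L)))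
      (Φ₂ : SchwartzBruhat (Fin (n₂ + n₂) → v.adicCompletion (maximalRealSubfield L))),
      Λ (boxSB (v.adicCompletion (maximalRealSubfield L)) (blkIdx n₁ n₂) Φ₁ Φ₂) =
        (∫ x : Fin (n₁ + n₁) → v.adicCompletion (maximalRealSubfield L),
            ((Γ₁ Φ₁ : SchwartzBruhat (Fin (n₁ + n₁) → v.adicCompletion (maximalRealSubfield L))) :
              (Fin (n₁ + n₁) → v.adicCompletion (maximalRealSubfield L)) → ℂ) x ∂(Measure.pi fun _ => μ)) *
          ((Γ₂ Φ₂ : SchwartzBruhat (Fin (n₂ + n₂) → v.adicCompletion (maximalRealSubfield L))) :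
            (Fin (n₂ + n₂) → v.adicCompletion (maximalRealSubfield L)) → ℂ) 0) :
    ∃ c : ℂ, c ≠ 0 ∧ ∀ Ψ : SchwartzBruhat (Fin ((n₁ + n₂) + (n₁ + n₂)) → v.adicCompletion (maximalRealSubfield L)),
      swSectionLoc L v
          (localSplittingDatumCM L v μ (n₁ + n₂) (UnitaryGroup.isSymm_finSum hT₁ hT₂) (isUnit_det_finSum L n₁ n₂ hT₁d hT₂d) rfl χ hχ).localSplitting
          m₀ Ψ
          (blkLoc (maximalRealSubfield L) L (IsCMField.complexConj L) v n₁ n₂ (T₁ := T₁) (T₂ := T₂) rfl rfl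
            (weylDelta (maximalRealSubfield L) L (IsCMField.complexConj L) v n₁ (T₀ := T₁) rfl)) =
        c * Λ Ψ := by
  obtain ⟨c, hc0, hc⟩ := exists_ne_zero_swSectionLoc_boxSB_blkLoc_weylDelta L v μ n₁ n₂ hT₁ hT₂ hT₁d hT₂d χ hχ hn₁ t₁ hT₁t hTv₁ m₀ hm₀
    E₁ hE₁ Γ₁ hΓ₁ B₁ hW₁ hm E₂ hE₂ Γ₂ hΓ₂
  refine ⟨c, hc0, fun Ψ => ?_⟩
  -- `Ψ ↦ F_Ψ(w₁)` as a linear functional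
  let A : SchwartzBruhat (Fin ((n₁ + n₂) + (n₁ + n₂)) → v.adicCompletion (maximalRealSubfield L)) →ₗ[ℂ] ℂ :=
    { toFun := fun Ψ => swSectionLoc L v
          (localSplittingDatumCM L v μ (n₁ + n₂) (UnitaryGroup.isSymm_finSum hT₁ hT₂) (isUnit_det_finSum L n₁ n₂ hT₁d hT₂d) rfl χ hχ).localSplitting
          m₀ Ψ
          (blkLoc (maximalRealSubfield L) L (IsCMField.complexConj L) v n₁ n₂ (T₁ := T₁) (T₂ := T₂) rfl rfl
            (weylDelta (maximalRealSubfield L) L (IsCMField.complexConj L) v n₁ (T₀ := T₁) rfl))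
      map_add' := fun Ψ Ψ' => swSectionLoc_add L v _ m₀ Ψ Ψ' _
      map_smul' := fun a Ψ => swSectionLoc_smul L v _ m₀ a Ψ _ }
  have hA : A = c • Λ := by
    refine linearMap_ext_boxSB (v.adicCompletion (maximalRealSubfield L)) (blkIdx n₁ n₂) fun Φ₁ Φ₂ => ?_
    rw [LinearMap.smul_apply, smul_eq_mul, hΛ Φ₁ Φ₂]
    exact hc Φ₁ Φ₂
  exact (LinearMap.congr_fun hA Ψ).trans (by rw [LinearMap.smul_apply, smul_eq_mul])

end Summit.HodgeConjecture.HodgeConjecture.Cruxes.HLiu418.K2LiuLocalSWMiddleCellFunctional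

end
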